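import Literature.NumberTheory.LFunctions.BaezDuarteReflection
import Literature.Analysis.FunctionSpaces.PlancherelL1L2
import HarnessLib

/-!
# Báez-Duarte's reflection is an isometry on Nyman–Beurling approximants; polarized
# Mellin–Parseval

Topic `Literature/NumberTheory/LFunctions`. For real dilations `a_j ≥ 1` and real coefficients
`c_j` put `f = χ - Σ_j c_j ρ_{a_j}` (`χ = 𝟙_{(0,1]}`, `ρ_a(t) = {1/(at)}`; this is the function
whose `L²(0,∞)` norm is the Nyman–Beurling error, `Literature.NumberTheory.LFunctions.baezDuarte_iff`) and
`f♯ = Uχ - Σ_j c_j Uρ_{a_j} = sin(2πt)/(πt) - Σ_j c_j {a_j t}/(a_j t)` (Báez-Duarte's `Uf`, file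
`BaezDuarteReflection.lean`). We prove:

* `hasMellin_nbFun` : `M[f](s) = (1 + ζ(s)P(s))/s`, `P(s) = Σ c_j a_j^{-s}`, on `0 < Re s < 1`
  (Báez-Duarte 2003, (2.4));
* `hasMellin_nbDual` : `M[f♯](s) = (χ̃(s) + ζ(1-s)P(s))/(1-s)`, hence
  `M[f♯] = U(s)·M[f]` (`mellin_nbDual_eq`) with `U(s) = sχ̃(s)/(1-s)`;
* `integral_norm_sq_nbDual_eq` : `∫_0^∞ |f♯|² = ∫_0^∞ |f|²` — "`U` is unitary" restricted to these
  functions, from Mellin–Plancherel (`Literature.Analysis.FunctionSpaces.integral_norm_sq_mellin_half_eq`) and `|U(1/2+iτ)| = 1`;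
* `HasMellin.add/sub/const_mul/finset_sum` : chaining forms of Mathlib's Mellin linearity lemmas;
* `integral_mellin_mul_conj` : the polarized Mellin–Parseval identity
  `∫ M[h](1/2+iτ) conj(M[k](1/2+iτ)) dτ = 2π ∫_0^∞ h k̄` for `h, k ∈ L¹(t^{-1/2}dt) ∩ L²`.

These are the inputs of the proof of the Báez-Duarte–Balazard–Landreau–Saias lower bound
`‖χ - Σ c_j ρ_{a_j}‖ ≥ C/√log N` (`Literature.Barriers.RiemannHypothesis.BDBLS2000_uniform`, the intended user).

## References

* J.-F. Burnol, *A lower bound in an approximation problem involving the zeros of the Riemann zeta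
  function*, Adv. Math. 170 (2002), 56–70, §3 (the Mellin–Plancherel isometry `K → L²(s=1/2+iτ)`,
  Báez-Duarte's `U` with multiplier `(s/(1-s))ζ(1-s)/ζ(s)`, unitary).
* L. Báez-Duarte, Rend. Lincei (9) 14 (2003), 5–11, §2.2 (2.4) (`M[f](s)` for the approximants).
* E. C. Titchmarsh, *Introduction to the Theory of Fourier Integrals*, 2nd ed., 1948, Thm. 71–72
  (Parseval for Mellin transforms), via `Literature/Analysis/FunctionSpaces/PlancherelL1L2.lean`.
-/

noncomputable section

open Complex MeasureTheory Set Filter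
open scoped Real Topology ComplexConjugate

namespace Literature.NumberTheory.LFunctions

namespace BaezDuarteU

open ZetaM4 (feFactor)

/-! ## Linearity of absolutely convergent Mellin transforms

Dot-notation conveniences on Mathlib's `HasMellin` (deliberate extensions of the Mathlib
namespace `HasMellin`, derived from Mathlib's `hasMellin_add`/`hasMellin_sub`/
`MellinConvergent.const_smul`), in the form "`HasMellin f s F → HasMellin g s G → …`" that chains. -/

section linearity

variable {f g : ℝ → ℂ} {s F G : ℂ}

/-- `HasMellin` is additive (from Mathlib `hasMellin_add`; deliberate dot-notation extension of
Mathlib's `HasMellin`). [folklore] -/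
theorem _root_.HasMellin.add (hf : HasMellin f s F) (hg : HasMellin g s G) :
    HasMellin (fun t ↦ f t + g t) s (F + G) := by
  obtain ⟨h1, h2⟩ := hasMellin_add hf.1 hg.1
  exact ⟨h1, by rw [h2, hf.2, hg.2]⟩

/-- `HasMellin` is compatible with subtraction (from Mathlib `hasMellin_sub`; deliberate
dot-notation extension of Mathlib's `HasMellin`). [folklore] -/
theorem _root_.HasMellin.sub (hf : HasMellin f s F) (hg : HasMellin g s G) :
    HasMellin (fun t ↦ f t - g t) s (F - G) := by
  obtain ⟨h1, h2⟩ := hasMellin_sub hf.1 hg.1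
  exact ⟨h1, by rw [h2, hf.2, hg.2]⟩

/-- `HasMellin` is compatible with scalar multiplication (from Mathlib
`hasMellin_const_smul`; deliberate dot-notation extension of Mathlib's `HasMellin`). [folklore] -/
theorem _root_.HasMellin.const_mul (hf : HasMellin f s F) (c : ℂ) :
    HasMellin (fun t ↦ c * f t) s (c * F) := by
  obtain ⟨h1, h2⟩ := hasMellin_const_smul hf.1 c
  simp only [smul_eq_mul] at h1 h2
  exact ⟨h1, by rw [h2, hf.2]⟩

/-- `HasMellin` for finite sums (deliberate dot-notation extension of Mathlib's `HasMellin`).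
[folklore] -/
theorem _root_.HasMellin.finset_sum {ι : Type*} (S : Finset ι) {f : ι → ℝ → ℂ} {F : ι → ℂ}
    (h : ∀ i ∈ S, HasMellin (f i) s (F i)) :
    HasMellin (fun t ↦ ∑ i ∈ S, f i t) s (∑ i ∈ S, F i) := by
  classical
  induction S using Finset.induction_on with
  | empty =>
    refine ⟨?_, ?_⟩
    · have : (fun t : ℝ ↦ (t : ℂ) ^ (s - 1) • ∑ i ∈ (∅ : Finset ι), f i t) = fun _ ↦ 0 := by
        funext t; simp
      rw [MellinConvergent, this]
      exact integrable_zero ℝ ℂ _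
    · simp [mellin]
  | insert i S hi ih =>
    have h1 : HasMellin (f i) s (F i) := h i (Finset.mem_insert_self i S)
    have h2 := ih fun j hj ↦ h j (Finset.mem_insert_of_mem hj)
    have := h1.add h2
    simpa [Finset.sum_insert hi] using this

end linearity

/-- A Mellin transform convergent at `σ` converges on the whole line `Re s = σ`. [folklore] -/
theorem mellinConvergent_of_re_eq {f : ℝ → ℂ} (hfm : AEStronglyMeasurable f (volume.restrict (Ioi 0)))
    {s s' : ℂ} (hre : s'.re = s.re) (hf : MellinConvergent f s) : MellinConvergent f s' := by
  rw [MellinConvergent, mellin_convergent_iff_norm Subset.rfl measurableSet_Ioi hfm] at hf ⊢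
  rwa [hre]

/-! ## The approximant `f = χ - Σ c_j ρ_{a_j}` and its reflection `f♯ = Uf` -/

variable {n : ℕ}

/-- The Dirichlet "polynomial" `P(s) = Σ_j c_j a_j^{-s}` (real dilations `a_j > 0`).
[cite: BaezDuarte2003, §2.2 (2.4)] -/
def dirichletSum (a c : Fin n → ℝ) (s : ℂ) : ℂ :=
  ∑ j, (c j : ℂ) * (a j : ℂ) ^ (-s)

/-- The Nyman–Beurling approximation error function `f = χ - Σ_j c_j {1/(a_j t)}`, complex-valued
(the real expression inside is literally the integrand of the `L²` norm in
`Literature.NumberTheory.LFunctions.baezDuarte_iff` / `Literature.Barriers.RiemannHypothesis.genError`).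
[cite: BaezDuarte2003, §1 (1.3)] -/
def nbFun (a c : Fin n → ℝ) (t : ℝ) : ℂ :=
  (((Ioc (0 : ℝ) 1).indicator 1 t - ∑ j, c j * Int.fract (1 / (a j * t)) : ℝ) : ℂ)

/-- Báez-Duarte's reflection `f♯ = Uf = sin(2πt)/(πt) - Σ_j c_j {a_j t}/(a_j t)` of `f = nbFun a c`.
[cite: Burnol2002, §3] -/
def nbDual (a c : Fin n → ℝ) (t : ℝ) : ℂ :=
  Literature.Analysis.SpecialFunctions.sincKernel t - ∑ j, (c j : ℂ) * fractDiv (a j) t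

variable (a c : Fin n → ℝ)

/-- Unfolding of `nbFun` into complex pieces. [folklore] -/
theorem nbFun_eq (t : ℝ) : nbFun a c t =
    (Ioc (0 : ℝ) 1).indicator (fun _ ↦ (1 : ℂ)) t -
      ∑ j, (c j : ℂ) * ((Int.fract (1 / (a j * t)) : ℝ) : ℂ) := by
  unfold nbFun
  push_cast
  congr 1
  by_cases ht : t ∈ Ioc (0 : ℝ) 1 <;> simp [ht]

/-- `nbFun a c` is measurable. [folklore] -/
theorem measurable_nbFun : Measurable (nbFun a c) := by
  unfold nbFun
  refine Complex.measurable_ofReal.comp ?_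
  refine ((measurable_one.indicator measurableSet_Ioc).sub (Finset.measurable_sum _ fun j _ ↦ ?_))
  exact measurable_const.mul (measurable_fract.comp (by fun_prop))

/-- `nbDual a c` is measurable. [folklore] -/
theorem measurable_nbDual : Measurable (nbDual a c) := by
  unfold nbDual
  refine Literature.Analysis.SpecialFunctions.measurable_sincKernel.sub
    (Finset.measurable_sum _ fun j _ ↦ ?_)
  exact measurable_const.mul (measurable_fractDiv _)

/-- **Mellin transform of the approximant** (Báez-Duarte 2003, (2.4)): for `a_j > 0` and
`0 < Re s < 1`, `M[χ - Σ c_j ρ_{a_j}](s) = (1 + ζ(s) Σ c_j a_j^{-s})/s`. [cite: BaezDuarte2003, §2.2 (2.4)] -/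
theorem hasMellin_nbFun (ha : ∀ j, 0 < a j) {s : ℂ} (hs0 : 0 < s.re) (hs1 : s.re < 1) :
    HasMellin (nbFun a c) s ((1 + riemannZeta s * dirichletSum a c s) / s) := by
  have h1 : HasMellin ((Ioc (0 : ℝ) 1).indicator fun _ ↦ (1 : ℂ)) s (1 / s) := hasMellin_one_Ioc hs0
  have h2 : HasMellin (fun t ↦ ∑ j, (c j : ℂ) * ((Int.fract (1 / (a j * t)) : ℝ) : ℂ)) s
      (∑ j, (c j : ℂ) * ((a j : ℂ) ^ (-s) * (-riemannZeta s / s))) :=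
    HasMellin.finset_sum _ fun j _ ↦
      (BaezDuarteOnlyIf.hasMellin_fract_one_div_mul (ha j) hs0 hs1).const_mul _
  have h := h1.sub h2
  have hfun : (fun t ↦ (Ioc (0 : ℝ) 1).indicator (fun _ ↦ (1 : ℂ)) t -
      ∑ j, (c j : ℂ) * ((Int.fract (1 / (a j * t)) : ℝ) : ℂ)) = nbFun a c :=
    funext fun t ↦ (nbFun_eq a c t).symm
  rw [hfun] at h
  refine ⟨h.1, h.2.trans ?_⟩
  have e : ∀ j ∈ Finset.univ, (c j : ℂ) * ((a j : ℂ) ^ (-s) * (-riemannZeta s / s)) =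
      -((riemannZeta s * ((c j : ℂ) * (a j : ℂ) ^ (-s))) / s) := fun j _ ↦ by ring
  rw [Finset.sum_congr rfl e, Finset.sum_neg_distrib, ← Finset.sum_div, ← Finset.mul_sum]
  unfold dirichletSum
  ring

/-- **Mellin transform of the reflected approximant**: for `a_j > 0` and `0 < Re s < 1`,
`M[f♯](s) = (χ̃(s) + ζ(1-s) Σ c_j a_j^{-s})/(1-s)`. [cite: Burnol2002, §3] -/
theorem hasMellin_nbDual (ha : ∀ j, 0 < a j) {s : ℂ} (hs0 : 0 < s.re) (hs1 : s.re < 1) :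
    HasMellin (nbDual a c) s ((feFactor s + riemannZeta (1 - s) * dirichletSum a c s) / (1 - s)) := by
  have h1 : HasMellin Literature.Analysis.SpecialFunctions.sincKernel s (feFactor s / (1 - s)) :=
    ⟨Literature.Analysis.SpecialFunctions.mellinConvergent_sincKernel hs0 hs1, mellin_sincKernel_eq hs0 hs1⟩
  have h2 : HasMellin (fun t ↦ ∑ j, (c j : ℂ) * fractDiv (a j) t) s
      (∑ j, (c j : ℂ) * (-(a j : ℂ) ^ (-s) * riemannZeta (1 - s) / (1 - s))) :=
    HasMellin.finset_sum _ fun j _ ↦ (hasMellin_fractDiv (ha j) hs0 hs1).const_mul _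
  have h := h1.sub h2
  refine ⟨h.1, h.2.trans ?_⟩
  have e : ∀ j ∈ Finset.univ, (c j : ℂ) * (-(a j : ℂ) ^ (-s) * riemannZeta (1 - s) / (1 - s)) =
      -((riemannZeta (1 - s) * ((c j : ℂ) * (a j : ℂ) ^ (-s))) / (1 - s)) := fun j _ ↦ by ring
  rw [Finset.sum_congr rfl e, Finset.sum_neg_distrib, ← Finset.sum_div, ← Finset.mul_sum]
  unfold dirichletSum
  ring

/-- **`M[Uf] = U · M[f]`** on the strip: `M[f♯](s) = U(s) M[f](s)` for `0 < Re s < 1`, by the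
functional equation `ζ(1-s) = χ̃(s)ζ(s)`. [cite: Burnol2002, §3] -/
theorem mellin_nbDual_eq (ha : ∀ j, 0 < a j) {s : ℂ} (hs0 : 0 < s.re) (hs1 : s.re < 1) :
    mellin (nbDual a c) s = uSymbol s * mellin (nbFun a c) s := by
  rw [(hasMellin_nbDual a c ha hs0 hs1).2, (hasMellin_nbFun a c ha hs0 hs1).2, uSymbol]
  have hs : s ≠ 0 := fun h ↦ by simp [h] at hs0
  have hsn1 : s ≠ 1 := fun h ↦ by simp [h] at hs1
  have h1s : 1 - s ≠ 0 := fun h ↦ by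
    have := congrArg Complex.re h; simp at this; linarith
  rw [riemannZeta_one_sub_eq_feFactor_mul (ne_neg_nat_of_re_pos hs0) hsn1]
  field_simp

/-- On the critical line, `|M[f♯]| = |M[f]|`. [cite: Burnol2002, §3] -/
theorem norm_mellin_nbDual_half (ha : ∀ j, 0 < a j) (τ : ℝ) :
    ‖mellin (nbDual a c) (1 / 2 + τ * I)‖ = ‖mellin (nbFun a c) (1 / 2 + τ * I)‖ := by
  rw [mellin_nbDual_eq a c ha (by simp) (by simp; norm_num), norm_mul, norm_uSymbol_half, one_mul]

/-- `f = χ - Σ c_j ρ_{a_j} ∈ L²((0,∞))` for `a_j ≥ 1`. [folklore] -/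
theorem memLp_two_nbFun (ha : ∀ j, 1 ≤ a j) : MemLp (nbFun a c) 2 (volume.restrict (Ioi (0 : ℝ))) := by
  unfold nbFun
  refine MemLp.ofReal ?_
  refine MemLp.sub ?_ (memLp_finsetSum _ fun j _ ↦ (memLp_two_fract_one_div (ha j)).const_mul _)
  exact memLp_indicator_const 2 measurableSet_Ioc 1 (Or.inr (by
    rw [Measure.restrict_apply measurableSet_Ioc]
    exact ((measure_mono inter_subset_left).trans_lt measure_Ioc_lt_top).ne))

/-- `f♯ ∈ L²((0,∞))` for `a_j ≥ 1`. [folklore] -/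
theorem memLp_two_nbDual (ha : ∀ j, 1 ≤ a j) : MemLp (nbDual a c) 2 (volume.restrict (Ioi (0 : ℝ))) := by
  unfold nbDual
  exact memLp_two_sincKernel.sub (memLp_finsetSum _ fun j _ ↦ (memLp_two_fractDiv (ha j)).const_mul _)

/-- `∫_0^∞ |f|² < ∞`. [folklore] -/
theorem integrableOn_norm_sq_nbFun (ha : ∀ j, 1 ≤ a j) :
    IntegrableOn (fun t ↦ ‖nbFun a c t‖ ^ 2) (Ioi 0) :=
  (memLp_two_iff_integrable_sq_norm (measurable_nbFun a c).aestronglyMeasurable).1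
    (memLp_two_nbFun a c ha)

/-- `∫_0^∞ |f♯|² < ∞`. [folklore] -/
theorem integrableOn_norm_sq_nbDual (ha : ∀ j, 1 ≤ a j) :
    IntegrableOn (fun t ↦ ‖nbDual a c t‖ ^ 2) (Ioi 0) :=
  (memLp_two_iff_integrable_sq_norm (measurable_nbDual a c).aestronglyMeasurable).1
    (memLp_two_nbDual a c ha)

/-- `M[f]` converges absolutely on the critical line. [folklore] -/
theorem mellinConvergent_nbFun_half (ha : ∀ j, 1 ≤ a j) : MellinConvergent (nbFun a c) (1 / 2) := by
  have := (hasMellin_nbFun a c (fun j ↦ by linarith [ha j]) (s := 1 / 2) (by norm_num) (by norm_num)).1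
  exact this

/-- `M[f♯]` converges absolutely on the critical line. [folklore] -/
theorem mellinConvergent_nbDual_half (ha : ∀ j, 1 ≤ a j) : MellinConvergent (nbDual a c) (1 / 2) := by
  have := (hasMellin_nbDual a c (fun j ↦ by linarith [ha j]) (s := 1 / 2) (by norm_num) (by norm_num)).1
  exact this

/-- **`U` is an isometry on Nyman–Beurling approximants**: `∫_0^∞ |f♯|² = ∫_0^∞ |f|²` for
`f = χ - Σ c_j ρ_{a_j}`, `a_j ≥ 1` (Mellin–Plancherel on both sides and `|U| = 1` on the critical
line: Burnol's "`U` … is unitary"). [cite: Burnol2002, §3] -/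
theorem integral_norm_sq_nbDual_eq (ha : ∀ j, 1 ≤ a j) :
    ∫ t in Ioi (0 : ℝ), ‖nbDual a c t‖ ^ 2 = ∫ t in Ioi (0 : ℝ), ‖nbFun a c t‖ ^ 2 := by
  have ha0 : ∀ j, 0 < a j := fun j ↦ by linarith [ha j]
  have h1 := Literature.Analysis.FunctionSpaces.integral_norm_sq_mellin_half_eq
    (mellinConvergent_nbFun_half a c ha) (integrableOn_norm_sq_nbFun a c ha)
  have h2 := Literature.Analysis.FunctionSpaces.integral_norm_sq_mellin_half_eq
    (mellinConvergent_nbDual_half a c ha) (integrableOn_norm_sq_nbDual a c ha)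
  have h3 : ∫ τ : ℝ, ‖mellin (nbDual a c) (1 / 2 + τ * I)‖ ^ 2 =
      ∫ τ : ℝ, ‖mellin (nbFun a c) (1 / 2 + τ * I)‖ ^ 2 :=
    integral_congr_ae (Eventually.of_forall fun τ ↦ by simp only [norm_mellin_nbDual_half a c ha0])
  have h2π : (0 : ℝ) < 2 * π := by positivity
  have := h2.2.symm.trans (h3.trans h1.2)
  exact mul_left_cancel₀ h2π.ne' this

/-! ## Polarized Mellin–Parseval -/

/-- Polarization of `x ȳ` in `ℂ`. [folklore] -/
lemma mul_conj_eq_polar (x y : ℂ) : x * conj y =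
    (((‖x + y‖ ^ 2 - ‖x - y‖ ^ 2 : ℝ) : ℂ) + ((‖x + I * y‖ ^ 2 - ‖x - I * y‖ ^ 2 : ℝ) : ℂ) * I) / 4 := by
  simp only [← Complex.normSq_eq_norm_sq, Complex.normSq_apply]
  apply Complex.ext <;> simp <;> ring

section parseval

variable {h k : ℝ → ℂ}

/-- `τ ↦ M[k](1/2 + iτ)` is continuous when `M[k]` converges absolutely at `1/2`
(dominated convergence, `|t^{iτ}| = 1`). [folklore] -/
theorem continuous_mellin_half (hk : MellinConvergent k (1 / 2)) :
    Continuous fun τ : ℝ ↦ mellin k (1 / 2 + τ * I) := by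
  have hF : ∀ τ : ℝ, ∀ t ∈ Ioi (0 : ℝ), (t : ℂ) ^ ((1 / 2 : ℂ) + τ * I - 1) • k t =
      (t : ℂ) ^ ((τ : ℂ) * I) • ((t : ℂ) ^ ((1 / 2 : ℂ) - 1) • k t) := by
    intro τ t ht
    have ht' : (t : ℂ) ≠ 0 := by exact_mod_cast (ne_of_gt ht)
    rw [smul_smul, ← cpow_add _ _ ht']
    congr 2; ring
  simp only [mellin]
  refine continuous_of_dominated (bound := fun t ↦ ‖(t : ℂ) ^ ((1 / 2 : ℂ) - 1) • k t‖) ?_ ?_ hk.norm ?_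
  · intro τ
    have h1 : AEStronglyMeasurable (fun t : ℝ ↦ (t : ℂ) ^ ((τ : ℂ) * I) • ((t : ℂ) ^ ((1 / 2 : ℂ) - 1) • k t))
        (volume.restrict (Ioi 0)) := by
      exact ((Complex.measurable_ofReal.pow_const ((τ : ℂ) * I)).aestronglyMeasurable
        (μ := volume.restrict (Ioi 0))).smul hk.aestronglyMeasurable
    exact h1.congr ((ae_restrict_iff' measurableSet_Ioi).2 (Eventually.of_forall fun t ht ↦ (hF τ t ht).symm))
  · intro τ
    refine (ae_restrict_iff' measurableSet_Ioi).2 (Eventually.of_forall fun t ht ↦ ?_)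
    rw [hF τ t ht, norm_smul, norm_cpow_eq_rpow_re_of_pos ht]
    simp
  · refine (ae_restrict_iff' measurableSet_Ioi).2 (Eventually.of_forall fun t ht ↦ ?_)
    have ht' : (t : ℂ) ≠ 0 := by exact_mod_cast (ne_of_gt ht)
    haveI : NeZero (t : ℂ) := ⟨ht'⟩
    have hc : Continuous fun τ : ℝ ↦ (t : ℂ) ^ ((1 / 2 : ℂ) + τ * I - 1) :=
      (continuous_const_cpow (t : ℂ)).comp (by fun_prop)
    exact hc.smul continuous_const

/-- The class `L¹(t^{-1/2}dt) ∩ L²` on `(0,∞)` is stable under `h + u k`, and `M` is linear there.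
[folklore] -/
lemma polar_aux (hhm : AEStronglyMeasurable h (volume.restrict (Ioi 0)))
    (hkm : AEStronglyMeasurable k (volume.restrict (Ioi 0)))
    (hh : MellinConvergent h (1 / 2)) (hk : MellinConvergent k (1 / 2))
    (hh2 : IntegrableOn (fun t ↦ ‖h t‖ ^ 2) (Ioi 0)) (hk2 : IntegrableOn (fun t ↦ ‖k t‖ ^ 2) (Ioi 0))
    (u : ℂ) :
    MellinConvergent (fun t ↦ h t + u * k t) (1 / 2) ∧
      IntegrableOn (fun t ↦ ‖h t + u * k t‖ ^ 2) (Ioi 0) ∧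
      (∀ τ : ℝ, mellin (fun t ↦ h t + u * k t) (1 / 2 + τ * I) =
        mellin h (1 / 2 + τ * I) + u * mellin k (1 / 2 + τ * I)) := by
  have hL2h : MemLp h 2 (volume.restrict (Ioi 0)) := (memLp_two_iff_integrable_sq_norm hhm).2 hh2
  have hL2k : MemLp k 2 (volume.restrict (Ioi 0)) := (memLp_two_iff_integrable_sq_norm hkm).2 hk2
  refine ⟨?_, ?_, fun τ ↦ ?_⟩
  · exact (HasMellin.add ⟨hh, rfl⟩ (HasMellin.const_mul ⟨hk, rfl⟩ u)).1
  · exact (memLp_two_iff_integrable_sq_norm (hhm.add (hkm.const_mul u))).1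
      (hL2h.add (hL2k.const_mul u))
  · have hh' : MellinConvergent h (1 / 2 + τ * I) := mellinConvergent_of_re_eq hhm (by simp) hh
    have hk' : MellinConvergent k (1 / 2 + τ * I) := mellinConvergent_of_re_eq hkm (by simp) hk
    exact (HasMellin.add ⟨hh', rfl⟩ (HasMellin.const_mul ⟨hk', rfl⟩ u)).2

/-- Integrating the polarization identity: for complex-valued `F, G` on a measure space with
`‖F + uG‖²` integrable for `u = ±1, ±i`,
`∫ F Ḡ = ((∫|F+G|² - ∫|F-G|²) + (∫|F+iG|² - ∫|F-iG|²) i)/4`. [folklore] -/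
lemma integral_mul_conj_eq_polar {α : Type*} [MeasurableSpace α] {μ : Measure α} {F G : α → ℂ}
    (hI : ∀ u : ℂ, Integrable (fun x ↦ ‖F x + u * G x‖ ^ 2) μ) :
    ∫ x, F x * conj (G x) ∂μ =
      ((((∫ x, ‖F x + 1 * G x‖ ^ 2 ∂μ) - ∫ x, ‖F x + (-1) * G x‖ ^ 2 ∂μ : ℝ) : ℂ) +
        (((∫ x, ‖F x + I * G x‖ ^ 2 ∂μ) - ∫ x, ‖F x + (-I) * G x‖ ^ 2 ∂μ : ℝ) : ℂ) * I) / 4 := by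
  have hpt : ∀ x, F x * conj (G x) =
      ((((‖F x + 1 * G x‖ ^ 2 - ‖F x + (-1) * G x‖ ^ 2 : ℝ) : ℂ)) +
        ((‖F x + I * G x‖ ^ 2 - ‖F x + (-I) * G x‖ ^ 2 : ℝ) : ℂ) * I) / 4 := by
    intro x
    have := mul_conj_eq_polar (F x) (G x)
    rw [this]
    congr 3 <;> push_cast <;> ring_nf
  simp_rw [hpt]
  have i1 : Integrable (fun x ↦ (((‖F x + 1 * G x‖ ^ 2 - ‖F x + (-1) * G x‖ ^ 2 : ℝ) : ℂ))) μ :=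
    ((hI 1).sub (hI (-1))).ofReal
  have i2 : Integrable (fun x ↦ ((‖F x + I * G x‖ ^ 2 - ‖F x + (-I) * G x‖ ^ 2 : ℝ) : ℂ) * I) μ :=
    ((hI I).sub (hI (-I))).ofReal.mul_const I
  rw [integral_div, integral_add i1 i2, integral_mul_const, integral_complex_ofReal,
    integral_complex_ofReal, integral_sub (hI 1) (hI (-1)), integral_sub (hI I) (hI (-I))]

/-- **Polarized Mellin–Parseval.** For `h, k : (0,∞) → ℂ` with `∫_0^∞ |h| t^{-1/2} dt < ∞`,
`∫_0^∞ |h|² < ∞` and likewise for `k`: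
`∫_{-∞}^{∞} M[h](1/2+iτ) conj(M[k](1/2+iτ)) dτ = 2π ∫_0^∞ h(t) conj(k(t)) dt`, both integrals
converging absolutely (polarization of `Literature.Analysis.FunctionSpaces.integral_norm_sq_mellin_half_eq`; Titchmarsh,
*Fourier Integrals*, Thm. 71–72). [folklore] -/
theorem integral_mellin_mul_conj (hhm : AEStronglyMeasurable h (volume.restrict (Ioi 0)))
    (hkm : AEStronglyMeasurable k (volume.restrict (Ioi 0)))
    (hh : MellinConvergent h (1 / 2)) (hk : MellinConvergent k (1 / 2))
    (hh2 : IntegrableOn (fun t ↦ ‖h t‖ ^ 2) (Ioi 0)) (hk2 : IntegrableOn (fun t ↦ ‖k t‖ ^ 2) (Ioi 0)) :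
    Integrable (fun τ : ℝ ↦ mellin h (1 / 2 + τ * I) * conj (mellin k (1 / 2 + τ * I))) ∧
      ∫ τ : ℝ, mellin h (1 / 2 + τ * I) * conj (mellin k (1 / 2 + τ * I)) =
        2 * π * ∫ t in Ioi (0 : ℝ), h t * conj (k t) := by
  have P := fun u : ℂ ↦ polar_aux hhm hkm hh hk hh2 hk2 u
  have N := fun u : ℂ ↦
    Literature.Analysis.FunctionSpaces.integral_norm_sq_mellin_half_eq (P u).1 (P u).2.1
  set Mh : ℝ → ℂ := fun τ ↦ mellin h (1 / 2 + τ * I) with hMh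
  set Mk : ℝ → ℂ := fun τ ↦ mellin k (1 / 2 + τ * I) with hMk
  have hM : ∀ (u : ℂ) (τ : ℝ), mellin (fun t ↦ h t + u * k t) (1 / 2 + τ * I) = Mh τ + u * Mk τ :=
    fun u τ ↦ (P u).2.2 τ
  -- the norm identities, rewritten
  have hS : ∀ u : ℂ, Integrable (fun τ : ℝ ↦ ‖Mh τ + u * Mk τ‖ ^ 2) ∧
      ∫ τ : ℝ, ‖Mh τ + u * Mk τ‖ ^ 2 = 2 * π * ∫ t in Ioi (0 : ℝ), ‖h t + u * k t‖ ^ 2 := by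
    intro u
    have e : (fun τ : ℝ ↦ ‖mellin (fun t ↦ h t + u * k t) (1 / 2 + τ * I)‖ ^ 2) =
        fun τ : ℝ ↦ ‖Mh τ + u * Mk τ‖ ^ 2 := funext fun τ ↦ by rw [hM]
    have h1 := (N u).1
    have h2 := (N u).2
    rw [e] at h1 h2
    exact ⟨h1, h2⟩
  -- integrability of `Mh conj Mk`
  have hIh : Integrable (fun τ : ℝ ↦ ‖Mh τ‖ ^ 2) :=
    (Literature.Analysis.FunctionSpaces.integral_norm_sq_mellin_half_eq hh hh2).1
  have hIk : Integrable (fun τ : ℝ ↦ ‖Mk τ‖ ^ 2) :=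
    (Literature.Analysis.FunctionSpaces.integral_norm_sq_mellin_half_eq hk hk2).1
  have hint : Integrable (fun τ : ℝ ↦ Mh τ * conj (Mk τ)) := by
    have hmeas : AEStronglyMeasurable (fun τ : ℝ ↦ Mh τ * conj (Mk τ)) volume :=
      ((continuous_mellin_half hh).mul
        (Complex.continuous_conj.comp (continuous_mellin_half hk))).aestronglyMeasurable
    have hb : Integrable (fun τ : ℝ ↦ (‖Mh τ‖ ^ 2 + ‖Mk τ‖ ^ 2) / 2) := (hIh.add hIk).div_const 2
    refine Integrable.mono' hb hmeas (Eventually.of_forall fun τ ↦ ?_)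
    rw [norm_mul, Complex.norm_conj]
    nlinarith [sq_nonneg (‖Mh τ‖ - ‖Mk τ‖)]
  refine ⟨hint, ?_⟩
  -- polarize both sides
  rw [integral_mul_conj_eq_polar (fun u ↦ (hS u).1), integral_mul_conj_eq_polar (fun u ↦ (P u).2.1)]
  simp only [(hS _).2]
  push_cast
  ring

end parseval

end BaezDuarteU

end Literature.NumberTheory.LFunctions
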